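/-
pub-hubbard cell (planner pub-hubbard-r3, gen 14). Ladder R1–R4 with certified numbers; no claim on
`H`/`H₀`. This file certifies NO number.
-/
import Summits.HubbardSuperconductivity.HubbardLadder.PairGapCeiling
import Summits.HubbardSuperconductivity.HubbardLadder.PairFieldCeilingUniform
import Summits.HubbardSuperconductivity.HubbardSuperconductivity.Theorems.AbsenceCertificateSourcedOrderDominatesLRO
import HarnessLib

/-!
# An energy-only R4⁻ certificate, route #2 — part 1/2: the sourced-energy INEQUALITIES

HONEST FRAMING (cell pub-hubbard, unit R3/R4). Ladder R1–R4 with certified numbers; no claim on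
`H`/`H₀` (`Summit.HubbardSuperconductivity`); this file certifies NO number.

This module is §1–§2 of r3 g14's `PairSourceEnergyCeiling.lean` (LEAN FILING REQUEST #132), split
off by the literature seat ONLY because cell files are limited to 400 lines (`lint.size`); every
declaration below is byte-identical to the staged text. §3–§4 (the certificate type
`PairSourceEnergyCert`, its consequences, the OPEN node `SmallPairSourceResponsePureU8Eighth` and
the edges to `NoDWaveOrderPureU8Eighth` / `PureModelStripeCompetition`) live in
`Summits.HubbardSuperconductivity.HubbardLadder.PairSourceEnergyCeiling`, which imports this
module and carries the full module documentation, references and magnitude estimates.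

§1: the eigenvector form of the Koma–Tasaki / Kaplan–Horsch–von der Linden trial-state bound
(`groundEnergy_source_mul_le_of_eigen`) and its slack arithmetic (`normSq_le_of_slack`). §2: the
sourced-energy inequality for Hubbard sector ground states on the torus
(`two_mul_re_pair_le_of_sourcedSlack`, `dWaveSourceDensity_le_of_sourcedSlack`).

References: T. A. Kaplan, P. Horsch, W. von der Linden, J. Phys. Soc. Jpn. 58 (1989) 3894; T.
Koma, H. Tasaki, J. Stat. Phys. 76 (1994) 745, Theorem 2.2 and §1.
-/

noncomputable section

namespace Summit.HubbardSuperconductivity.HubbardLadder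

open Matrix Filter Literature.Probability.LatticeModels
open Literature.MathematicalPhysics.QuantumLattice
open Literature.Barriers.HubbardSuperconductivity (PureModelStripeCompetition)
open Summit.HubbardSuperconductivity.HubbardSuperconductivity.Theorems.WcbcsTrialState
open Summit.HubbardSuperconductivity.HubbardSuperconductivity.Theorems.AbsenceCertificate
  (kt_norm_doubleCommutator_le kt_two_mul_re_pair_le_re_order_sq
    kt_isNParticle_of_groundStateInSector kt_re_expect_hubbardTorusWith)
open scoped Matrix.Norms.L2Operator ComplexOrder Topology

/-! ## §1 The abstract trial-state inequality and its arithmetic -/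

/-- **Eigenvector form of the Koma–Tasaki trial-state bound.** `K, O` Hermitian, `Kψ = Eψ`,
`‖ψ‖ = 1`, selection rules `⟨ψ, Oψ⟩ = 0 = ⟨Oψ, O(Oψ)⟩`; then for all real `h, t`,
`E₀(K - hO)(1 + t²‖Oψ‖²) ≤ E(1 + t²‖Oψ‖²) - 2th‖Oψ‖² - (t²/2) Re⟨ψ, [O,[O,K]]ψ⟩`, where
`[O,[O,K]] = O(OK - KO) - (OK - KO)O`. Trial vector `ψ + t·Oψ`; `⟨Oψ, K Oψ⟩` is evaluated with the
double-commutator identity `two_mul_re_sandwich_eq` and `⟨O(Oψ), Kψ⟩ = E‖Oψ‖²`.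
[cite: KomaTasaki1994, Theorem 2.2] [cite: KaplanHorschVonDerLinden1989] -/
theorem groundEnergy_source_mul_le_of_eigen {m : Type*} [Fintype m] [DecidableEq m] [Nonempty m]
    {K O : Matrix m m ℂ} (hK : K.IsHermitian) (hO : O.IsHermitian) {Ψ : m → ℂ}
    (hΨ : star Ψ ⬝ᵥ Ψ = 1) {E : ℝ} (hE : K *ᵥ Ψ = (E : ℂ) • Ψ)
    (hV1 : star Ψ ⬝ᵥ (O *ᵥ Ψ) = 0) (hV3 : star (O *ᵥ Ψ) ⬝ᵥ (O *ᵥ (O *ᵥ Ψ)) = 0) (h t : ℝ) :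
    (K - (h : ℂ) • O).groundEnergy * (1 + t ^ 2 * (star (O *ᵥ Ψ) ⬝ᵥ (O *ᵥ Ψ)).re) ≤
      E * (1 + t ^ 2 * (star (O *ᵥ Ψ) ⬝ᵥ (O *ᵥ Ψ)).re)
        - 2 * t * h * (star (O *ᵥ Ψ) ⬝ᵥ (O *ᵥ Ψ)).re
        - t ^ 2 / 2 * (star Ψ ⬝ᵥ ((O * (O * K - K * O) - (O * K - K * O) * O) *ᵥ Ψ)).re := by
  have hsand := two_mul_re_sandwich_eq hK hO Ψ
  set Φ := O *ᵥ Ψ with hΦ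
  set q : ℝ := eucNorm Φ ^ 2 with hq
  have hΦΦ : star Φ ⬝ᵥ Φ = (q : ℂ) := star_dotProduct_self_eq_eucNorm_sq Φ
  have hqre : (star Φ ⬝ᵥ Φ).re = q := by rw [hΦΦ, Complex.ofReal_re]
  -- selection rules and the eigenvalue equation
  have hΦΨ : star Φ ⬝ᵥ Ψ = 0 := by
    rw [hΦ, ← star_dotProduct_mulVec_of_isHermitian hO]; exact hV1
  have hΨOΦ : star Ψ ⬝ᵥ (O *ᵥ Φ) = (q : ℂ) := by
    rw [star_dotProduct_mulVec_of_isHermitian hO, ← hΦ, hΦΦ]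
  have hΦOΨ : star Φ ⬝ᵥ (O *ᵥ Ψ) = (q : ℂ) := by rw [← hΦ, hΦΦ]
  have hΨKΨ : star Ψ ⬝ᵥ (K *ᵥ Ψ) = (E : ℂ) := by
    rw [hE, dotProduct_smul, hΨ, smul_eq_mul, mul_one]
  have hΦKΨ : star Φ ⬝ᵥ (K *ᵥ Ψ) = 0 := by
    rw [hE, dotProduct_smul, hΦΨ, smul_zero]
  have hΨKΦ : star Ψ ⬝ᵥ (K *ᵥ Φ) = 0 := by
    rw [star_dotProduct_mulVec_of_isHermitian hK, hE, star_smul, smul_dotProduct, hV1, smul_zero]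
  have hOΦKΨ : star (O *ᵥ Φ) ⬝ᵥ (K *ᵥ Ψ) = (E : ℂ) * (q : ℂ) := by
    rw [hE, dotProduct_smul, smul_eq_mul, ← star_dotProduct_mulVec_of_isHermitian hO, hΦOΨ]
  -- `2 Re⟨Φ, KΦ⟩ = 2 E q - d`
  rw [hOΦKΨ, ← Complex.ofReal_mul, Complex.ofReal_re] at hsand
  have hX : (star Φ ⬝ᵥ (K *ᵥ Φ)).re = E * q -
      (star Ψ ⬝ᵥ ((O * (O * K - K * O) - (O * K - K * O) * O) *ᵥ Ψ)).re / 2 := by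
    linarith
  -- the trial vector
  set Ξ := Ψ + (t : ℂ) • Φ with hΞ
  have hΞΞ : (star Ξ ⬝ᵥ Ξ).re = 1 + t ^ 2 * q := by
    have h1 := star_dotProduct_mulVec_add_smul 1 Ψ Φ t
    simp only [one_mulVec] at h1
    rw [hΞ, h1, hΨ, hV1, hΦΨ, hΦΦ]
    simp only [mul_zero, add_zero, Complex.add_re, Complex.one_re]
    rw [← Complex.ofReal_pow, ← Complex.ofReal_mul, Complex.ofReal_re]
  have hΞOΞ : (star Ξ ⬝ᵥ (O *ᵥ Ξ)).re = 2 * t * q := by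
    rw [hΞ, star_dotProduct_mulVec_add_smul O Ψ Φ t, hV1, hΨOΦ, hΦOΨ, hV3, mul_zero, add_zero,
      zero_add, ← Complex.ofReal_mul, ← Complex.ofReal_add, Complex.ofReal_re]
    ring
  have hΞKΞ : (star Ξ ⬝ᵥ (K *ᵥ Ξ)).re = E + t ^ 2 * (star Φ ⬝ᵥ (K *ᵥ Φ)).re := by
    rw [hΞ, star_dotProduct_mulVec_add_smul K Ψ Φ t, hΨKΦ, hΦKΨ, mul_zero, add_zero, add_zero,
      hΨKΨ, Complex.add_re, Complex.ofReal_re, ← Complex.ofReal_pow, Complex.re_ofReal_mul]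
  -- the variational principle for `K - hO`
  have hvar := groundEnergy_mul_le_re (isHermitian_sub_real_smul hK hO h) Ξ
  have hKΞ : (star Ξ ⬝ᵥ ((K - (h : ℂ) • O) *ᵥ Ξ)).re =
      (star Ξ ⬝ᵥ (K *ᵥ Ξ)).re - h * (star Ξ ⬝ᵥ (O *ᵥ Ξ)).re := by
    rw [sub_mulVec, smul_mulVec, dotProduct_sub, dotProduct_smul, Complex.sub_re, smul_eq_mul,
      Complex.re_ofReal_mul]
  rw [hKΞ, hΞΞ, hΞOΞ, hΞKΞ, hX] at hvar
  rw [hqre]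
  linarith

/-- **The arithmetic of the slack.** If `E₀(1 + t²q) ≤ E(1 + t²q) - 2thq - t²d/2` for all real `t`,
`0 < h`, `0 < S`, `E - E₀ ≤ S` and `-d ≤ D`, then `q ≤ S²/h² + D/(2S)` (take `t = h/S`). [folklore] -/
theorem normSq_le_of_slack {E₀ E q d D S h : ℝ} (hh : 0 < h) (hS : 0 < S) (hq : 0 ≤ q)
    (hdD : -d ≤ D) (hslack : E - E₀ ≤ S)
    (hineq : ∀ t : ℝ, E₀ * (1 + t ^ 2 * q) ≤ E * (1 + t ^ 2 * q) - 2 * t * h * q - t ^ 2 / 2 * d) :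
    q ≤ S ^ 2 / h ^ 2 + D / (2 * S) := by
  have hh0 : h ≠ 0 := hh.ne'
  have hS0 : S ≠ 0 := hS.ne'
  have ht := hineq (h / S)
  have h1q : (0 : ℝ) ≤ 1 + (h / S) ^ 2 * q := by positivity
  have h1 : 2 * (h / S) * h * q + (h / S) ^ 2 / 2 * d ≤ S * (1 + (h / S) ^ 2 * q) := by
    have := mul_le_mul_of_nonneg_right hslack h1q
    linarith
  have h2 : -((h / S) ^ 2 * d) ≤ (h / S) ^ 2 * D := by
    have := mul_le_mul_of_nonneg_left hdD (sq_nonneg (h / S))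
    linarith
  have h3 : 2 * (h / S) * h * q = 2 * (S * ((h / S) ^ 2 * q)) := by
    field_simp
    try ring
  have h4 : S * ((h / S) ^ 2 * q) ≤ S + (h / S) ^ 2 * D / 2 := by linarith
  have h5 : S * ((h / S) ^ 2 * q) = q * (h ^ 2 / S) := by
    field_simp
    try ring
  have h6 : S + (h / S) ^ 2 * D / 2 = (S ^ 2 / h ^ 2 + D / (2 * S)) * (h ^ 2 / S) := by
    field_simp
    try ring
  rw [h5, h6] at h4
  exact le_of_mul_le_mul_right h4 (by positivity)

/-! ## §2 The sourced-energy inequality for Hubbard sector ground states -/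

/-- **Sector ground-state pair-field size is controlled by the sourced-energy slack.** There are
constants `B₂ > 0`, `B_p ≥ 0` (the tree's graded-locality budgets, valid for all real `U`) such that
for every side `L ≥ 1`, all real `U, μ`, all `h > 0`, `S > 0`, every `N` and every normalised
ground state `ψ` of `H(1,U) = hubbardTorus 2 L 1 U` in the sector `(N, S^z = 0)`:
if `E_N(L) - μN - E₀(dWaveSourceTorus L U μ h) ≤ S` then
`2 Re⟨ψ, Δ_d†Δ_d ψ⟩ ≤ S²/h² + B₂(1+|U|+|μ|)L²/(2S) + B_p L²`. No canonical-support hypothesis,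
no trial-state optimality, no numerics. [cite: KomaTasaki1994, Theorem 2.2]
[cite: KaplanHorschVonDerLinden1989] -/
theorem two_mul_re_pair_le_of_sourcedSlack :
    ∃ B₂ Bp : ℝ, 0 < B₂ ∧ 0 ≤ Bp ∧ ∀ (L : ℕ) [NeZero L] (U μ h S : ℝ), 0 < h → 0 < S →
      ∀ (N : ℕ) (ψ : Fock (Orb (FermionTorus 2 L))), star ψ ⬝ᵥ ψ = 1 →
        IsGroundStateInSector (hubbardTorus 2 L 1 U) N 0 ψ →
        (hubbardTorus 2 L 1 U).minEnergyOn (szSector N 0) - μ * N -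
            (dWaveSourceTorus L U μ h).groundEnergy ≤ S →
        2 * (expect ((pairField dWaveFormFactor L)ᴴ * pairField dWaveFormFactor L) ψ).re ≤
          S ^ 2 / h ^ 2 + B₂ * (1 + |U| + |μ|) * (L : ℝ) ^ 2 / (2 * S) + Bp * (L : ℝ) ^ 2 := by
  obtain ⟨B₂, hB₂, hDn⟩ := kt_norm_doubleCommutator_le
  obtain ⟨Bp, hBp, hpair⟩ := kt_two_mul_re_pair_le_re_order_sq
  refine ⟨B₂, Bp, hB₂, hBp, fun L _ U μ h S hh hS N ψ hψ1 hgs hslack => ?_⟩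
  set X := pairField dWaveFormFactor L with hX_def
  set O := X + Xᴴ with hO_def
  set K := hubbardTorusWith 2 L 1 U μ with hK_def
  have hK : K.IsHermitian := isHermitian_hubbardTorusWith L 1 U μ
  have hO : O.IsHermitian := isHermitian_pairField_add_conjTranspose L
  have hψn : IsNParticle N ψ := kt_isNParticle_of_groundStateInSector hgs
  have hNψ := HubbardSuperconductivity.Theorems.WcbcsTrialState.totalNumber_mulVec_of_isNParticle hψn
  have hNh : (totalNumber : Matrix (Finset (Orb (FermionTorus 2 L))) _ ℂ).IsHermitian :=
    totalNumber_isHermitian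
  have hNΔ := totalNumber_commutator_pairField_dWave L
  have hV1 : star ψ ⬝ᵥ (O *ᵥ ψ) = 0 := star_dotProduct_charged_mulVec_eq_zero hNh hNΔ hNψ
  have hV3 : star (O *ᵥ ψ) ⬝ᵥ (O *ᵥ (O *ᵥ ψ)) = 0 :=
    star_charged_mulVec_dotProduct_eq_zero hNh hNΔ hNψ
  -- the eigenvalue equation for `K = H(1,U) - μN`
  set Esec : ℝ := (hubbardTorus 2 L 1 U).minEnergyOn (szSector N 0) with hEsec
  have hE : K *ᵥ ψ = ((Esec - μ * N : ℝ) : ℂ) • ψ := by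
    rw [hK_def, hubbardTorusWith_eq, sub_mulVec, smul_mulVec, hgs.2.2, hNψ, smul_smul,
      ← sub_smul]
    congr 1
    push_cast
    ring
  -- §1 for `K - hO = dWaveSourceTorus L U μ h`
  have hsrc : dWaveSourceTorus L U μ h = K - (h : ℂ) • O := rfl
  have hineq : ∀ t : ℝ, (dWaveSourceTorus L U μ h).groundEnergy *
      (1 + t ^ 2 * (star (O *ᵥ ψ) ⬝ᵥ (O *ᵥ ψ)).re) ≤
      (Esec - μ * N) * (1 + t ^ 2 * (star (O *ᵥ ψ) ⬝ᵥ (O *ᵥ ψ)).re)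
        - 2 * t * h * (star (O *ᵥ ψ) ⬝ᵥ (O *ᵥ ψ)).re
        - t ^ 2 / 2 * (star ψ ⬝ᵥ ((O * (O * K - K * O) - (O * K - K * O) * O) *ᵥ ψ)).re := by
    intro t
    rw [hsrc]
    exact groundEnergy_source_mul_le_of_eigen hK hO hψ1 hE hV1 hV3 h t
  -- the double-commutator budget bounds `-d`
  have hψn' : eucNorm ψ = 1 := eucNorm_eq_one hψ1
  have hDnorm : ‖O * (O * K - K * O) - (O * K - K * O) * O‖ ≤ B₂ * (1 + |U| + |μ|) * (L : ℝ) ^ 2 :=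
    hDn L U μ
  have hdD : -(star ψ ⬝ᵥ ((O * (O * K - K * O) - (O * K - K * O) * O) *ᵥ ψ)).re ≤
      B₂ * (1 + |U| + |μ|) * (L : ℝ) ^ 2 := by
    have := re_star_dotProduct_mulVec_le (-(O * (O * K - K * O) - (O * K - K * O) * O)) ψ
    rw [neg_mulVec, dotProduct_neg, Complex.neg_re, norm_neg, hψn', one_pow, mul_one] at this
    exact this.trans hDnorm
  -- `q = ‖Oψ‖² ≥ 0` and the slack
  have hq0 : 0 ≤ (star (O *ᵥ ψ) ⬝ᵥ (O *ᵥ ψ)).re := by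
    rw [star_dotProduct_self_eq_eucNorm_sq, Complex.ofReal_re]; positivity
  have hmain := normSq_le_of_slack hh hS hq0 hdD hslack hineq
  -- `2 Re⟨Δ†Δ⟩ ≤ ‖Oψ‖² + B_p L²`
  have hqO : (expect (O * O) ψ).re = (star (O *ᵥ ψ) ⬝ᵥ (O *ᵥ ψ)).re := by
    rw [expect, ← mulVec_mulVec, star_dotProduct_mulVec_of_isHermitian hO]
  have hp := hpair L ψ N hψ1 hψn
  rw [hqO] at hp
  linarith

/-- **The one-point order parameter is controlled by the same slack** (tree's energy sandwich, no
trial state): for a normalised sector ground state `ψ` as above and any `S` with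
`E_N(L) - μN - E₀(dWaveSourceTorus L U μ h) ≤ S` (any real `h`):
`h L² · dWaveSourceDensity L U μ (h/2) ≤ S`. Indeed `E₀(K) ≤ ⟨ψ, Kψ⟩ = E_N - μN` (variational
principle), `E₀(K_{h/2}) ≤ E₀(K)` and `(h/2)·2L²·m_L(h/2) ≤ E₀(K_{h/2}) - E₀(K_h)`.
[cite: KomaTasaki1994, §1] -/
theorem dWaveSourceDensity_le_of_sourcedSlack (L : ℕ) [NeZero L] (U μ h S : ℝ)
    {N : ℕ} {ψ : Fock (Orb (FermionTorus 2 L))} (hψ1 : star ψ ⬝ᵥ ψ = 1)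
    (hgs : IsGroundStateInSector (hubbardTorus 2 L 1 U) N 0 ψ)
    (hslack : (hubbardTorus 2 L 1 U).minEnergyOn (szSector N 0) - μ * N -
      (dWaveSourceTorus L U μ h).groundEnergy ≤ S) :
    h * (L : ℝ) ^ 2 * dWaveSourceDensity L U μ (h / 2) ≤ S := by
  have hK : (hubbardTorusWith 2 L 1 U μ).IsHermitian := isHermitian_hubbardTorusWith L 1 U μ
  -- `E₀(K) ≤ E_N - μN`
  have h0 : (dWaveSourceTorus L U μ 0).groundEnergy ≤
      (hubbardTorus 2 L 1 U).minEnergyOn (szSector N 0) - μ * N := by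
    have hvar := groundEnergy_mul_le_re hK ψ
    rw [hψ1, Complex.one_re, mul_one] at hvar
    rw [dWaveSourceTorus_zero, ← kt_re_expect_hubbardTorusWith μ hψ1 hgs]
    exact hvar
  have h1 := groundEnergy_dWaveSourceTorus_le (L := L) U μ (h / 2)
  have h2 := dWaveSourceDensity_mul_le_groundEnergy_drop (L := L) U μ (h / 2) h
  have h3 : (h - h / 2) * (2 * (L : ℝ) ^ 2 * dWaveSourceDensity L U μ (h / 2)) =
      h * (L : ℝ) ^ 2 * dWaveSourceDensity L U μ (h / 2) := by ring
  linarith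

end Summit.HubbardSuperconductivity.HubbardLadder

end
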